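import Summits.QuantumAdvantage.AdviceFreeQNC0.BlockComb37Data
import HarnessLib

/-!
# Cell qa-qnc0 — P-37c (c2)+(c3): the BLOCK-COMB THEOREM and «(G₁) FOR EVERY GATE»
# (planner qa-qnc0-p1 gen 37; imports the (c1) file `BlockFibreLaw37` = exp37/BlockFibreLaw37.lean once ported)

(c2) `blockComb_le` — THE COMB THEOREM OVER BLOCK FAMILIES.  Data (`CombData n K`): a family of `K` blocks of walk
bits with pairwise disjoint neighbourhoods `[lo k, hi k] ⊇ [st k − 1, st k + len k]`, a LOCAL goodness predicate
`Good k` (reads only the neighbourhood, is invariant under complementing its own block, implies admissibility) and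
two resampling positions `pc k, pd k` in the neighbourhood such that from every input some combination of the two bit
flips reaches a good one (so `P(Good k | everything else) ≥ 1/4`).  Conclusion: some `θ < 1`; for every `C` some
`A, n₀`; for `n ≥ n₀` and `K ≥ A (log₂ n)^{2C+1}`: window-local branches (window `(log₂ n)^C`) selected by ANY
selector that is blind to the complement of every GOOD block win the `p = 3` ring/walk game on `≤ θ·2ⁿ` inputs.
  Proof: (A) averaging identity `2^K·#WIN = Σ_a N(a)`, `N(a) = #{v : WIN(blockExt a v)}`; (B) for a background with
  `s = #GoodSet(a) > t` a second averaging over the good coordinates + (C) re-basing to the good sub-family + (D) the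
  block-fibre law (c1) (`D = 2·window`, selector constant along good blocks) give `N(a) ≤ (1−c₀)2^K`; (E) few
  backgrounds have `≤ t` good blocks: `≤ C(K,t)(3/4)^{K−t}2ⁿ ≤ 2ⁿ/2` by the quarter lemma (a free `(ℤ/2)²`-action by
  two local bit flips with a good point in every orbit) and a product/union bound.
(c3) `everyGateHard : EveryGateHard` — (G₁) FOR EVERY COEFFICIENT WORD `ℓ`: among the coefficients at `6k+2, 6k+3,
6k+4` two are equal or opposite (`three_window`); the block between them (length 1 or 2) is gate-blind exactly when the
boundary input bits stand in the matching relation; these blocks form a `CombData n (n/6 − 1)`.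

(Part 3/4.) Cell qa-qnc0, crux stmt-QuantumAdvantage-22907.  AUTHORED AND PROVED BY THE PLANNER qa-qnc0-p1 gen 37 (P-37c (c2)+(c3), INBOX P1-37c 14:53Z, evidence #60 on stmt-22907, file `HOME/qa-qnc0-p1/exp37/BlockComb37.lean`, 1082 lines, sha db0f1086629d090a, rc 0 / 0 sorries); landed verbatim by qn-prover-3 g21 as a four-way split: `BlockComb37Fam` (§§0–3: typed targets `gateSum`/`EveryGateHard`/`GatesHardConst`, block algebra, sub-families, averaging identities + quarter lemma) → `BlockComb37Data` (§§4–5: `CombData`, local bit flips, the count on a background with many good blocks) → `BlockComb37` (§§6–8: few backgrounds have few good blocks, ★ `blockComb_le` THE BLOCK-COMB THEOREM, small-block bit calculus) → `BlockCombGate37` (§§9–10: the comb data of one gate, ★ `everyGateHard : EveryGateHard`).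
-/

noncomputable section

open Classical

namespace Summit.QuantumAdvantage.AdviceFreeQNC0

open Finset
open Literature.Computability.MetaComplexity Literature.Computability.MetaComplexity.Smolensky
open F4 AffBells22 Subcube

namespace BlockFibre37

variable {n m : ℕ}
variable {K : ℕ}

/-! ### 6. (E): few backgrounds have few good blocks -/

/-- all blocks of `T` are bad. -/
def BadAll (cd : CombData n K) (T : Finset (Fin K)) (a : Fin n → Bool) : Prop := ∀ k ∈ T, ¬ cd.Good k a

/-- flips in the neighbourhood of `k` do not change goodness of other blocks. -/
theorem good_flipB_iff (cd : CombData n K) {k k' : Fin K} (hne : k' ≠ k) {p : ℕ} (hp : cd.lo k ≤ p ∧ p ≤ cd.hi k)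
    (b : Bool) (a : Fin n → Bool) : cd.Good k' (flipB b p a) ↔ cd.Good k' a := by
  have hagree : ∀ i : Fin n, cd.lo k' ≤ i.val → i.val ≤ cd.hi k' → flipB b p a i = a i := by
    intro i hlo hhi
    apply flipB_apply_of_ne
    intro hip
    rcases lt_or_gt_of_ne hne with hlt | hlt
    · have := cd.disj k' k hlt; omega
    · have := cd.disj k k' hlt; omega
  constructor
  · exact cd.good_local k' _ _ hagree
  · exact cd.good_local k' _ _ fun i hlo hhi => (hagree i hlo hhi).symm

/-- **product bound**: `#{a : all of T bad} ≤ (3/4)^{|T|}·2ⁿ`. -/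
theorem card_badAll_le (cd : CombData n K) (T : Finset (Fin K)) :
    ((univ.filter fun a : Fin n → Bool => BadAll cd T a).card : ℝ) ≤ (3 / 4 : ℝ) ^ T.card * (2 : ℝ) ^ n := by
  induction T using Finset.induction_on with
  | empty =>
    have e : (univ.filter fun a : Fin n → Bool => BadAll cd ∅ a) = univ :=
      filter_true_of_mem fun a _ k hk => absurd hk (by simp)
    rw [e, card_univ, Fintype.card_fun, Fintype.card_bool, Fintype.card_fin, card_empty, pow_zero, one_mul]
    push_cast
    exact le_refl _
  | insert k T hk ih =>
    rw [card_insert_of_notMem hk, pow_succ]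
    set E := univ.filter fun a : Fin n → Bool => BadAll cd T a with hE
    have e : (univ.filter fun a : Fin n → Bool => BadAll cd (insert k T) a) = E.filter fun a => ¬ cd.Good k a := by
      ext a
      rw [hE, mem_filter, mem_filter, mem_filter]
      unfold BadAll
      simp only [mem_univ, true_and, Finset.forall_mem_insert]
      tauto
    rw [e]
    have hq := quarter E (cd.Good k) (fun s t a => flipB t (cd.pd k) (flipB s (cd.pc k) a)) ?_ ?_ (cd.abundant k)
    · calc ((E.filter fun a => ¬ cd.Good k a).card : ℝ) ≤ 3 / 4 * (E.card : ℝ) := hq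
        _ ≤ 3 / 4 * ((3 / 4 : ℝ) ^ T.card * (2 : ℝ) ^ n) := by gcongr
        _ = (3 / 4 : ℝ) ^ T.card * (3 / 4) * (2 : ℝ) ^ n := by ring
    · intro s t a ha
      rw [hE, mem_filter] at ha ⊢
      refine ⟨mem_univ _, fun k' hk' => ?_⟩
      have hne : k' ≠ k := fun e => hk (e ▸ hk')
      rw [good_flipB_iff cd hne (cd.pd_mem k), good_flipB_iff cd hne (cd.pc_mem k)]
      exact ha.2 k' hk'
    · intro s t a
      rw [flipB_comm t s, flipB_flipB, flipB_flipB]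

/-- **few backgrounds have at most `t` good blocks**: `≤ C(K,t)·(3/4)^{K−t}·2ⁿ`. -/
theorem card_fewGood_le (cd : CombData n K) {t : ℕ} (ht : t ≤ K) :
    ((univ.filter fun a : Fin n → Bool => (GoodSet cd a).card ≤ t).card : ℝ)
      ≤ (K.choose t : ℝ) * (3 / 4 : ℝ) ^ (K - t) * (2 : ℝ) ^ n := by
  set s := K - t with hs
  have hcover : (univ.filter fun a : Fin n → Bool => (GoodSet cd a).card ≤ t) ⊆
      ((univ : Finset (Fin K)).powersetCard s).biUnion (fun T => univ.filter fun a : Fin n → Bool => BadAll cd T a) := by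
    intro a ha
    rw [mem_filter] at ha
    rw [mem_biUnion]
    have hbad : s ≤ ((univ : Finset (Fin K)) \ GoodSet cd a).card := by
      rw [card_sdiff_of_subset (subset_univ _), card_univ, Fintype.card_fin]
      omega
    obtain ⟨T, hTsub, hTcard⟩ := exists_subset_card_eq hbad
    refine ⟨T, mem_powersetCard.2 ⟨fun x _ => mem_univ x, hTcard⟩, mem_filter.2 ⟨mem_univ _, fun k hk hg => ?_⟩⟩
    have hk' := mem_sdiff.1 (hTsub hk)
    exact hk'.2 (mem_filter.2 ⟨mem_univ _, hg⟩)
  calc ((univ.filter fun a : Fin n → Bool => (GoodSet cd a).card ≤ t).card : ℝ)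
      ≤ ((((univ : Finset (Fin K)).powersetCard s).biUnion
          (fun T => univ.filter fun a : Fin n → Bool => BadAll cd T a)).card : ℝ) := by
        exact_mod_cast card_le_card hcover
    _ ≤ ∑ T ∈ (univ : Finset (Fin K)).powersetCard s, ((univ.filter fun a : Fin n → Bool => BadAll cd T a).card : ℝ) := by
        exact_mod_cast card_biUnion_le
    _ ≤ ∑ T ∈ (univ : Finset (Fin K)).powersetCard s, (3 / 4 : ℝ) ^ s * (2 : ℝ) ^ n := by
        refine sum_le_sum fun T hT => ?_
        have h := card_badAll_le cd T
        rw [(mem_powersetCard.1 hT).2] at h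
        exact h
    _ = (K.choose t : ℝ) * (3 / 4 : ℝ) ^ (K - t) * (2 : ℝ) ^ n := by
        rw [sum_const, card_powersetCard, card_univ, Fintype.card_fin, nsmul_eq_mul, hs, Nat.choose_symm ht]
        ring

/-- the numerical side condition: `C(K,t)·(3/4)^{K−t} ≤ 1/2` once `(3L+4)t + 3 ≤ K ≤ n < 2^{L+1}`. -/
theorem choose_mul_pow_le_half {K t L n : ℕ} (hKn : K ≤ n) (hn : n < 2 ^ (L + 1)) (ht : (3 * L + 4) * t + 3 ≤ K) :
    (K.choose t : ℝ) * (3 / 4 : ℝ) ^ (K - t) ≤ 1 / 2 := by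
  have h1 : (K.choose t : ℝ) ≤ (2 : ℝ) ^ ((L + 1) * t) := by
    have a : K.choose t ≤ K ^ t := Nat.choose_le_pow K t
    have b : K ^ t ≤ (2 ^ (L + 1)) ^ t := Nat.pow_le_pow_left (by omega) t
    rw [← pow_mul] at b
    exact_mod_cast a.trans b
  have hq : 3 * ((L + 1) * t + 1) ≤ K - t := by
    have e : (3 * L + 4) * t + 3 = 3 * ((L + 1) * t + 1) + t := by ring
    rw [e] at ht
    generalize (L + 1) * t = P at ht ⊢
    omega
  have h2 : (3 / 4 : ℝ) ^ (K - t) ≤ (3 / 4 : ℝ) ^ (3 * ((L + 1) * t + 1)) :=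
    pow_le_pow_of_le_one (by norm_num) (by norm_num) hq
  have h3 : (3 / 4 : ℝ) ^ (3 * ((L + 1) * t + 1)) ≤ (1 / 2 : ℝ) ^ ((L + 1) * t + 1) := by
    rw [pow_mul]
    exact pow_le_pow_left₀ (by norm_num) (by norm_num) _
  calc (K.choose t : ℝ) * (3 / 4 : ℝ) ^ (K - t) ≤ (2 : ℝ) ^ ((L + 1) * t) * (1 / 2 : ℝ) ^ ((L + 1) * t + 1) :=
        mul_le_mul h1 (h2.trans h3) (by positivity) (by positivity)
    _ = 1 / 2 := by
        rw [pow_succ, ← mul_assoc, ← mul_pow]; norm_num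

/-- `K ≤ n`: the neighbourhoods are disjoint and inside `[0, n)`. -/
theorem K_le_n (cd : CombData n K) : K ≤ n := by
  have h := Fintype.card_le_of_injective (fun k : Fin K => (⟨cd.hi k, cd.hi_lt k⟩ : Fin n)) (by
    intro k k' hkk
    have hv : cd.hi k = cd.hi k' := by have := congrArg Fin.val hkk; simpa using this
    by_contra hne
    rcases lt_or_gt_of_ne hne with hlt | hlt
    · have h1 := cd.disj k k' hlt; have h2 := cd.lo_le k'; have h3 := cd.le_hi k'; omega
    · have h1 := cd.disj k' k hlt; have h2 := cd.lo_le k; have h3 := cd.le_hi k; omega)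
  simpa using h

/-! ### 7. (c2) THE BLOCK-COMB THEOREM -/

/-- **THE BLOCK-COMB THEOREM.** -/
theorem blockComb_le : ∃ θ : ℝ, θ < 1 ∧ ∀ C : ℕ, ∃ A n₀ : ℕ, ∀ n ≥ n₀, ∀ (K : ℕ) (cd : CombData n K),
    A * (Nat.log 2 n) ^ (2 * C + 1) ≤ K → ∀ (c : ℕ) (T : Type) (σ : (Fin n → Bool) → T)
    (G : T → Fin (n + 1) → (Fin n → Bool) → Bool),
    (∀ (u : Fin n → Bool) (k : Fin K), cd.Good k u → σ (cpl cd.fam k u) = σ u) →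
    (∀ t, WindowLocal ((Nat.log 2 n) ^ C) (G t)) →
    ((univ.filter fun u : Fin n → Bool => ringWinU c (fun g u => G (σ u) g u) u = true).card : ℝ)
      ≤ θ * (2 : ℝ) ^ n := by
  obtain ⟨c₀, hc₀, m₀, hcore⟩ := failSet_ge_of_mem_fullSpan
  refine ⟨1 - c₀ / 2, by linarith, fun C => ⟨7 * (m₀ + 9) + 3, 2, fun n hn K cd hA c T σ G hσ hloc => ?_⟩⟩
  have hn2 : 2 ≤ n := hn
  set L := Nat.log 2 n with hL
  set r := L ^ C with hr
  set t := m₀ + 9 * L ^ (2 * C) with ht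
  have hL1 : 1 ≤ L := Nat.le_log_of_pow_le (by norm_num) (by simpa using hn2)
  have hKn : K ≤ n := K_le_n cd
  have hnL : n < 2 ^ (L + 1) := Nat.lt_pow_succ_log_self (by norm_num) n
  -- room
  have hroom : (3 * L + 4) * t + 3 ≤ K := by
    have hL2C : 1 ≤ L ^ (2 * C) := Nat.one_le_pow _ _ hL1
    have hL2C1 : 1 ≤ L ^ (2 * C + 1) := Nat.one_le_pow _ _ hL1
    have a1 : m₀ ≤ m₀ * L ^ (2 * C) := Nat.le_mul_of_pos_right _ hL2C
    have a2 : t ≤ (m₀ + 9) * L ^ (2 * C) := by rw [ht, add_mul]; omega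
    have a3 : (3 * L + 4) * t ≤ 7 * L * ((m₀ + 9) * L ^ (2 * C)) :=
      le_trans (Nat.mul_le_mul_right _ (by omega)) (Nat.mul_le_mul_left _ a2)
    have a4 : 7 * L * ((m₀ + 9) * L ^ (2 * C)) = (7 * (m₀ + 9)) * L ^ (2 * C + 1) := by ring
    have a5 : (7 * (m₀ + 9) + 3) * L ^ (2 * C + 1) = (7 * (m₀ + 9)) * L ^ (2 * C + 1) + 3 * L ^ (2 * C + 1) := by ring
    have a6 := le_trans a3 (le_of_eq a4)
    rw [a5] at hA
    generalize (7 * (m₀ + 9)) * L ^ (2 * C + 1) = Y at a6 hA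
    omega
  have htK : t ≤ K := by nlinarith
  -- per-background counts
  set Q : (Fin n → Bool) → Prop := fun u => ringWinU c (fun g u => G (σ u) g u) u = true with hQ
  set N : (Fin n → Bool) → ℝ := fun a =>
    ((univ.filter fun v : Fin K → Bool => Q (blockExt cd.fam a v)).card : ℝ) with hN
  have hN1 : ∀ a, N a ≤ (2 : ℝ) ^ K := by
    intro a
    rw [hN]
    simp only
    have h : (univ.filter fun v : Fin K → Bool => Q (blockExt cd.fam a v)).card ≤ (univ : Finset (Fin K → Bool)).card :=
      card_le_card (filter_subset _ _)
    rw [card_univ, Fintype.card_fun, Fintype.card_bool, Fintype.card_fin] at h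
    exact_mod_cast h
  have hNg : ∀ a, ¬ (GoodSet cd a).card ≤ t → N a ≤ (1 - c₀) * (2 : ℝ) ^ K := by
    intro a ha
    rw [not_le] at ha
    have hm : m₀ ≤ (GoodSet cd a).card := by omega
    have hr1 : 1 ≤ r := Nat.one_le_pow _ _ hL1
    have hrr : (2 * r + 1) ^ 2 ≤ (GoodSet cd a).card := by
      have h9 : (2 * r + 1) ^ 2 ≤ 9 * r ^ 2 := by nlinarith
      have h9' : 9 * r ^ 2 = 9 * L ^ (2 * C) := by rw [hr, ← pow_mul, mul_comm C 2]
      omega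
    exact Na_le cd hcore σ G hσ hloc c a hm hrr
  -- bad backgrounds
  set bad := univ.filter fun a : Fin n → Bool => (GoodSet cd a).card ≤ t with hbad
  set good := univ.filter fun a : Fin n → Bool => ¬ (GoodSet cd a).card ≤ t with hgood
  have hbadR : (bad.card : ℝ) ≤ (2 : ℝ) ^ n / 2 := by
    have h1 := card_fewGood_le cd htK
    have h2 := choose_mul_pow_le_half hKn hnL hroom
    have h3 : (K.choose t : ℝ) * (3 / 4 : ℝ) ^ (K - t) * (2 : ℝ) ^ n ≤ 1 / 2 * (2 : ℝ) ^ n :=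
      mul_le_mul_of_nonneg_right h2 (by positivity)
    rw [hbad]
    linarith
  have hcards : (bad.card : ℝ) + good.card = (2 : ℝ) ^ n := by
    have h := card_filter_add_card_filter_not (s := (univ : Finset (Fin n → Bool)))
      (fun a : Fin n → Bool => (GoodSet cd a).card ≤ t)
    rw [card_univ, Fintype.card_fun, Fintype.card_bool, Fintype.card_fin] at h
    rw [hbad, hgood]
    exact_mod_cast h
  -- (A) first averaging
  have hA0 := avg_identity (fun (v : Fin K → Bool) (a : Fin n → Bool) => blockExt cd.fam a v)
    (fun v a => blockExt_invol cd.fam a v) Q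
  have hAR : (2 : ℝ) ^ K * ((univ.filter fun u : Fin n → Bool => Q u).card : ℝ) = ∑ a : Fin n → Bool, N a := by
    show (2 : ℝ) ^ K * ((univ.filter fun u : Fin n → Bool => Q u).card : ℝ)
      = ∑ a : Fin n → Bool, ((univ.filter fun v : Fin K → Bool => Q (blockExt cd.fam a v)).card : ℝ)
    exact_mod_cast hA0
  have hsplit : ∑ a : Fin n → Bool, N a = ∑ a ∈ bad, N a + ∑ a ∈ good, N a := by
    rw [hbad, hgood]; exact (sum_filter_add_sum_filter_not _ _ _).symm
  have hb : ∑ a ∈ bad, N a ≤ bad.card * (2 : ℝ) ^ K := by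
    have := Finset.sum_le_card_nsmul bad N ((2 : ℝ) ^ K) (fun a _ => hN1 a)
    rwa [nsmul_eq_mul] at this
  have hg : ∑ a ∈ good, N a ≤ good.card * ((1 - c₀) * (2 : ℝ) ^ K) := by
    have := Finset.sum_le_card_nsmul good N ((1 - c₀) * (2 : ℝ) ^ K)
      (fun a ha => hNg a (by rw [hgood, mem_filter] at ha; exact ha.2))
    rwa [nsmul_eq_mul] at this
  have hpos : (0 : ℝ) < (2 : ℝ) ^ K := by positivity
  have hc1 : c₀ ≤ 1 := by
    -- from the core bound at any admissible instance: use `hN1`/`hNg` consistency is not needed; derive from hcore at m₀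
    by_contra hlt
    rw [not_le] at hlt
    have h := hcore m₀ le_rfl 0 (Nat.zero_le _) 0 (Submodule.zero_mem _)
    have hle : ((failSetOf (0 : (Fin m₀ → Bool) → F4)).card : ℝ) ≤ (2 : ℝ) ^ m₀ := by
      have := card_le_card (filter_subset (fun u : Fin m₀ → Bool => tr ((0 : (Fin m₀ → Bool) → F4) u) ≠ 1) univ)
      rw [card_univ, Fintype.card_fun, Fintype.card_bool, Fintype.card_fin] at this
      exact_mod_cast this
    have hp : (0 : ℝ) < (2 : ℝ) ^ m₀ := by positivity
    nlinarith
  have key : (2 : ℝ) ^ K * ((univ.filter fun u : Fin n → Bool => Q u).card : ℝ)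
      ≤ (2 : ℝ) ^ K * ((1 - c₀ / 2) * (2 : ℝ) ^ n) := by
    rw [hAR, hsplit]
    have hgc : (good.card : ℝ) = (2 : ℝ) ^ n - bad.card := by linarith
    rw [hgc] at hg
    have hc' : c₀ * (bad.card : ℝ) ≤ c₀ * ((2 : ℝ) ^ n / 2) := mul_le_mul_of_nonneg_left hbadR hc₀.le
    nlinarith [hb, hg, hc', hpos, hc1]
  exact le_of_mul_le_mul_left key hpos


/-! ### 8. Small blocks: weights, bit flips and the hidden letters `x` -/

/-- A block weight is at most twice the block length. -/
theorem bwt_le_two_len (B : BlockFam n m) (u : Fin n → Bool) (k : Fin m) : bwt B u k ≤ 2 * B.len k := by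
  unfold bwt
  have h : (univ.filter fun i : Fin n => InBlock B k i ∧ u i = true).card ≤ (blk B k).card :=
    card_le_card fun i hi => by
      rw [mem_filter] at hi; unfold blk; rw [mem_filter]; exact ⟨mem_univ _, hi.2.1⟩
  rw [card_blk] at h
  omega

/-- flipping one bit inside the block moves the block weight by one. -/
theorem bwt_flipN_mem (B : BlockFam n m) (u : Fin n → Bool) {k : Fin m} {i₀ : Fin n} (h : InBlock B k i₀) :
    bwt B (flipN i₀.val u) k + (if u i₀ = true then 2 else 1) = bwt B u k + (if (!u i₀) = true then 2 else 1) := by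
  have hmem : i₀ ∈ blk B k := by unfold blk; rw [mem_filter]; exact ⟨mem_univ _, h⟩
  rw [← sum_blk_lett B (flipN i₀.val u) k, ← sum_blk_lett B u k,
    ← Finset.add_sum_erase (blk B k) (fun i => if flipN i₀.val u i = true then 2 else 1) hmem,
    ← Finset.add_sum_erase (blk B k) (fun i => if u i = true then 2 else 1) hmem]
  have hrest : ∑ i ∈ (blk B k).erase i₀, (if flipN i₀.val u i = true then 2 else 1)
      = ∑ i ∈ (blk B k).erase i₀, (if u i = true then 2 else 1) := by
    refine sum_congr rfl fun i hi => ?_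
    rw [flipN_apply_of_ne i₀.val u (fun e => (mem_erase.1 hi).1 (Fin.ext e))]
  have hhead : flipN i₀.val u i₀ = !u i₀ := by unfold flipN; rw [if_pos rfl]
  rw [hrest, hhead]
  cases u i₀ <;> simp <;> omega

/-- The walk bit `x_i` depends only on the extended input at `i − 1` and `i`. -/
theorem xOfU_congr {u u' : Fin n → Bool} (i : Fin (n + 1)) (h1 : uExt u i.val = uExt u' i.val)
    (h0 : uExt u (i.val - 1) = uExt u' (i.val - 1)) : xOfU u i = xOfU u' i := by
  unfold xOfU; rw [h1, h0]

/-- `uExt` at `q < n` depends only on the coordinate `q`. -/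
theorem uExt_congr {u u' : Fin n → Bool} {q : ℕ} (hq : q < n) (h : u ⟨q, hq⟩ = u' ⟨q, hq⟩) : uExt u q = uExt u' q := by
  unfold uExt; rw [dif_pos hq, dif_pos hq]; exact h

/-- A walk bit `x_i` with `i ∉ {p, p+1}` is unchanged by `flipN p`. -/
theorem xOfU_flipN_of_ne (p : ℕ) (u : Fin n → Bool) {i : Fin (n + 1)} (h1 : i.val ≠ p) (h2 : i.val ≠ p + 1) :
    xOfU (flipN p u) i = xOfU u i := by
  unfold xOfU
  rw [uExt_flipN, uExt_flipN, if_neg (show ¬ (i.val = p ∧ i.val < n) from fun h => h1 h.1),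
    if_neg (show ¬ (i.val - 1 = p ∧ i.val - 1 < n) by omega)]

/-- `flipN p` (`p < n`) negates the walk bit `x_p`. -/
theorem xOfU_flipN_self (p : ℕ) (u : Fin n → Bool) (hp : p < n) {i : Fin (n + 1)} (hi : i.val = p) :
    xOfU (flipN p u) i = !xOfU u i := by
  unfold xOfU
  rw [uExt_flipN, uExt_flipN, if_pos (show i.val = p ∧ i.val < n from ⟨hi, hi ▸ hp⟩)]
  by_cases h0 : i.val = 0
  · rw [if_pos h0, if_pos h0]
    cases uExt u i.val <;> rfl
  · rw [if_neg h0, if_neg h0, if_neg (show ¬ (i.val - 1 = p ∧ i.val - 1 < n) by omega)]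
    cases uExt u i.val <;> cases uExt u (i.val - 1) <;> rfl

/-- `flipN p` (`p < n`) negates the walk bit `x_{p+1}`. -/
theorem xOfU_flipN_succ (p : ℕ) (u : Fin n → Bool) (hp : p < n) {i : Fin (n + 1)} (hi : i.val = p + 1) :
    xOfU (flipN p u) i = !xOfU u i := by
  unfold xOfU
  rw [uExt_flipN, uExt_flipN, if_neg (show ¬ (i.val = p ∧ i.val < n) by omega), if_neg (show i.val ≠ 0 by omega),
    if_neg (show i.val ≠ 0 by omega), if_pos (show i.val - 1 = p ∧ i.val - 1 < n by omega)]
  cases uExt u i.val <;> cases uExt u (i.val - 1) <;> rfl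

/-- `flipB false` is the identity. -/
theorem flipB_false (p : ℕ) (u : Fin n → Bool) : flipB false p u = u := rfl
/-- `flipB true p = flipN p`. -/
theorem flipB_true (p : ℕ) (u : Fin n → Bool) : flipB true p u = flipN p u := rfl

/-- Split a finite sum into two named terms `a ≠ b` and the rest. -/
theorem sum_pair_rest {ι M : Type*} [Fintype ι] [DecidableEq ι] [AddCommMonoid M] {a b : ι} (h : a ≠ b) (g : ι → M) :
    ∑ i, g i = g a + g b + ∑ i ∈ (univ.erase a).erase b, g i := by
  rw [← Finset.add_sum_erase _ _ (mem_univ a), ← Finset.add_sum_erase _ _ (mem_erase.2 ⟨h.symm, mem_univ b⟩), add_assoc]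

end BlockFibre37

end Summit.QuantumAdvantage.AdviceFreeQNC0
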